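import Literature.Analysis.FluidPDE.SlicedLocalEnergy
import Literature.Analysis.FluidPDE.DistributionalToWeak
import HarnessLib

/-!
# Variants of the sliced local energy inequality `ae_localEnergy_slice`

Let `E` be a finite-dimensional real inner product space and `(u, p)` a suitable weak solution
of the forced Navier–Stokes system on an open space–time region `Q ⊆ ℝ × E` in the sense of
the accepted `Literature.Analysis.FluidPDE.IsSuitableWeakSolutionOn Q ν f u p`
(Caffarelli–Kohn–Nirenberg 1982, (2.1)–(2.5); Lin 1998, Def. 1). The accepted
`IsSuitableWeakSolutionOn.ae_localEnergy_slice` (`SlicedLocalEnergy.lean`) derives from the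
space–time local energy inequality of the structure its **sliced** form: for every nonnegative
`ζ ∈ C_c^∞(Q)` and a.e. `s`,

`∫ |u(s)|² ζ(s) dx + 2ν ∫∫_{t<s} |∇u|² ζ ≤ ∫∫_{t<s} (|u|² (ζₜ + νΔζ) + (|u|² + 2p) u·∇ζ + 2 (f·u) ζ)`.

This file adds the variants needed on **backward parabolic cylinders whose top lies on the
boundary of `Q`** (Lin 1998, (1.4); Seregin–Šverák 2009, Def. 2.2: cut-offs "vanishing in a
neighbourhood of the parabolic boundary of `Q`", sliced "for a.a. `t ∈ ]-1, 0[`"):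

* `localEnergyRHS ν f u p ζ` — a name for the right-hand integrand (it IS the integrand of the
  structure `IsSuitableWeakSolutionOn.localEnergy` and of `ae_localEnergy_slice`), with its
  calculus under time cut-offs `localEnergyRHS_mul_of_hasDerivAt` and its integrability
  `IsSuitableWeakSolutionOn.integrable_localEnergyRHS`;
* `IsSuitableWeakSolutionOn.ae_localEnergy_slice_ennreal` — the sliced inequality with its two
  nonnegative left-hand terms as lower Lebesgue integrals (`ν ≥ 0`);
* `IsSuitableWeakSolutionOn.ae_localEnergy_slice_of_forall_lt` and
  `…_ennreal_of_forall_lt` — the same conclusions for a.e. `s < T`, for nonnegative smooth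
  compactly supported `ζ` on `ℝ × E` that are supported in `Q` only *below every time level
  `τ < T`* (`tsupport ζ ∩ {t ≤ τ} ⊆ Q`). Proof: multiply `ζ` by smooth time cut-offs `θ_k = 1`
  on `(-∞, τ_k]`, `θ_k = 0` near `T`, `τ_k ↑ T` (`exists_time_level_cutoff`,
  `IsSpaceTimeTestOn.time_mul_of_forall_lt`), apply `ae_localEnergy_slice` to each `θ_k ζ`,
  and note that below `τ_k` nothing changes.

Application: Seregin–Šverák 2009, proof of Lemma 3.5, (as12)
(`SereginSverakLocalEnergy.lean`).

## References

* F. Lin, *A new proof of the Caffarelli–Kohn–Nirenberg theorem*, CPAM 51 (1998), Def. 1, (1.4).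
* G. Seregin, V. Šverák, *On Type I singularities of the local axi-symmetric solutions of the
  Navier–Stokes equations*, Comm. PDE 34 (2009), Def. 2.2 (arXiv:0804.1803, p. 6).
* L. Caffarelli, R. Kohn, L. Nirenberg, *Partial regularity of suitable weak solutions of the
  Navier–Stokes equations*, Comm. Pure Appl. Math. 35 (1982), §2, (2.5).
-/

noncomputable section

open MeasureTheory TopologicalSpace Set Function Filter Topology Metric InnerProductSpace
open scoped ENNReal NNReal RealInnerProductSpace Laplacian

namespace Literature.Analysis.FluidPDE

/-! ### The right-hand integrand and its calculus under time cut-offs -/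

section SliceCalculus

variable {E : Type*} [NormedAddCommGroup E] [InnerProductSpace ℝ E] [FiniteDimensional ℝ E]

omit [FiniteDimensional ℝ E] in
/-- `∇(c ζ) = c ∇ζ` at a point of differentiability (real scalars; the tree's
`gradient_const_smul` of `NSViscosityRescaling.lean`, restated to keep that file's classical
imports out of the weak-solution files). [folklore] -/
theorem gradient_fun_const_smul [CompleteSpace E] {q : E → ℝ} {x : E}
    (hq : DifferentiableAt ℝ q x) (c : ℝ) :
    gradient (fun y => c • q y) x = c • gradient q x := by
  simp only [gradient, fderiv_fun_const_smul hq, map_smulₛₗ, starRingEnd_apply, star_trivial]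

variable {Q : Opens (ℝ × E)} {ν : ℝ} {f u : ℝ → E → E} {p : ℝ → E → ℝ}

/-- The **right-hand integrand of the local energy inequality** (CKN 1982, (2.5); Lin 1998,
Def. 1): `R[ζ] = |u|² (ζₜ + νΔζ) + (|u|² + 2p) u·∇ζ + 2 (f·u) ζ`, as a function on
space–time, literally the integrand of the accepted `IsSuitableWeakSolutionOn.localEnergy` and
of `IsSuitableWeakSolutionOn.ae_localEnergy_slice`. [cite: Lin1998, Def. 1] -/
def localEnergyRHS (ν : ℝ) (f u : ℝ → E → E) (p : ℝ → E → ℝ) (ζ : ℝ → E → ℝ) (z : ℝ × E) : ℝ :=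
  ‖u z.1 z.2‖ ^ 2 * (timeDeriv ζ z.1 z.2 + ν * Δ (ζ z.1) z.2) +
    (‖u z.1 z.2‖ ^ 2 + 2 * p z.1 z.2) * ⟪u z.1 z.2, gradient (ζ z.1) z.2⟫ +
    2 * ⟪f z.1 z.2, u z.1 z.2⟫ * ζ z.1 z.2

/-- Unfolding `localEnergyRHS`. [folklore] -/
theorem localEnergyRHS_apply (ζ : ℝ → E → ℝ) (z : ℝ × E) :
    localEnergyRHS ν f u p ζ z =
      ‖u z.1 z.2‖ ^ 2 * (timeDeriv ζ z.1 z.2 + ν * Δ (ζ z.1) z.2) +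
        (‖u z.1 z.2‖ ^ 2 + 2 * p z.1 z.2) * ⟪u z.1 z.2, gradient (ζ z.1) z.2⟫ +
        2 * ⟪f z.1 z.2, u z.1 z.2⟫ * ζ z.1 z.2 :=
  rfl

/-- **Pointwise calculus of time cut-offs.** For a differentiable `θ : ℝ → ℝ` with
`θ' = dθ/dt` and a space–time test function `ζ`:
`R[θ ζ](t, x) = θ(t) R[ζ](t, x) + θ'(t) |u(t, x)|² ζ(t, x)`
(`∂ₜ(θζ) = θ' ζ + θ ζₜ`, `Δ(θζ) = θΔζ`, `∇(θζ) = θ∇ζ`). [folklore] -/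
theorem localEnergyRHS_mul_of_hasDerivAt {Q' : Opens (ℝ × E)} {ζ : ℝ → E → ℝ}
    (hζ : IsSpaceTimeTestOn Q' ζ) {θ θ' : ℝ → ℝ} (hθ : ∀ t, HasDerivAt θ (θ' t) t) (t : ℝ)
    (x : E) :
    localEnergyRHS ν f u p (fun t x => θ t * ζ t x) (t, x) =
      θ t * localEnergyRHS ν f u p ζ (t, x) + θ' t * (‖u t x‖ ^ 2 * ζ t x) := by
  have ht : timeDeriv (fun t x => θ t • ζ t x) t x = θ' t • ζ t x + θ t • timeDeriv ζ t x :=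
    timeDeriv_cutoff hθ hζ.hasDerivAt_time t x
  have hl : Δ (fun x => θ t • ζ t x) x = θ t • Δ (ζ t) x :=
    laplacian_fun_const_smul (contDiff_infty.1 (hζ.contDiff_slice t) 2) (θ t) x
  have hg : gradient (fun x => θ t • ζ t x) x = θ t • gradient (ζ t) x :=
    gradient_fun_const_smul
      (((hζ.contDiff_slice t).differentiable (by simp)).differentiableAt) (θ t)
  simp only [smul_eq_mul] at ht hl hg
  simp only [localEnergyRHS]
  rw [ht, hl, hg]
  simp only [real_inner_smul_right]
  ring

/-- **Smooth time cut-offs at a level.** For `δ > 0` there is a smooth `θ : ℝ → ℝ`, `θ ≥ 0`,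
with `θ = 1` on `(-∞, T - 3δ]`, `θ = 0` on `[T - δ, ∞)`, whose derivative `ρ` vanishes on
`(-∞, T - 3δ)` (reflect the tree's `exists_smooth_time_cutoff`). [folklore] -/
theorem exists_time_level_cutoff (T : ℝ) {δ : ℝ} (hδ : 0 < δ) :
    ∃ θ ρ : ℝ → ℝ, ContDiff ℝ (⊤ : ℕ∞) θ ∧ (∀ t, HasDerivAt θ (ρ t) t) ∧
      (∀ t, t ≤ T - 3 * δ → θ t = 1) ∧ (∀ t, T - δ ≤ t → θ t = 0) ∧
      (∀ t, t < T - 3 * δ → ρ t = 0) ∧ (∀ t, 0 ≤ θ t) := by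
  obtain ⟨η, ρ, hηs, -, hηd, hη0, hη1, hη01, -, hρ0, -⟩ := exists_smooth_time_cutoff hδ
  refine ⟨fun t => η (T - t), fun t => -ρ (T - t), hηs.comp (contDiff_const.sub contDiff_id),
    fun t => ?_, fun t ht => hη1 _ (by linarith), fun t ht => hη0 _ (by linarith),
    fun t ht => ?_, fun t => (hη01 _).1⟩
  · have h1 : HasDerivAt (fun t : ℝ => T - t) (-1) t := by
      simpa using (hasDerivAt_id t).const_sub T
    have h2 : HasDerivAt (fun t => η (T - t)) (ρ (T - t) * -1) t := (hηd (T - t)).comp t h1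
    simpa using h2
  · show -ρ (T - t) = 0
    rw [hρ0 _ (fun h => by linarith [h.2]), neg_zero]

omit [FiniteDimensional ℝ E] in
/-- A smooth compactly supported `ζ` on `ℝ × E`, supported in `Q` below every time level
`τ < T`, multiplied by a smooth `θ(t)` vanishing on `[a, ∞)` for some `a < T`, is a test
function on `Q`. [folklore] -/
theorem IsSpaceTimeTestOn.time_mul_of_forall_lt {ζ : ℝ → E → ℝ}
    (hζ : IsSpaceTimeTestOn (⊤ : Opens (ℝ × E)) ζ) {T : ℝ}
    (hζQ : ∀ τ < T, tsupport (uncurry ζ) ∩ {z | z.1 ≤ τ} ⊆ (Q : Set (ℝ × E))) {θ : ℝ → ℝ}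
    (hθs : ContDiff ℝ (⊤ : ℕ∞) θ) {a : ℝ} (ha : a < T) (hθ0 : ∀ t, a ≤ t → θ t = 0) :
    IsSpaceTimeTestOn Q (fun t x => θ t * ζ t x) := by
  obtain ⟨h1, h2, -⟩ := hζ.time_mul hθs
  refine ⟨h1, h2, ?_⟩
  have e : uncurry (fun t x => θ t * ζ t x) = (fun z : ℝ × E => θ z.1) * uncurry ζ := rfl
  rw [e]
  intro z hz
  refine hζQ a ha ⟨tsupport_mul_subset_right hz, ?_⟩
  have hz1 : z ∈ tsupport fun z : ℝ × E => θ z.1 := tsupport_mul_subset_left hz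
  have hsub : (tsupport fun z : ℝ × E => θ z.1) ⊆ {z | z.1 ≤ a} := by
    refine closure_minimal (fun w hw => ?_) (isClosed_le continuous_fst continuous_const)
    by_contra h
    exact hw (hθ0 w.1 (not_le.1 h).le)
  exact hsub hz1

end SliceCalculus

/-! ### The variants -/

section Main

variable {E : Type*} [NormedAddCommGroup E] [InnerProductSpace ℝ E] [FiniteDimensional ℝ E]
  [MeasurableSpace E] [BorelSpace E]

variable {Q : Opens (ℝ × E)} {ν : ℝ} {f u : ℝ → E → E} {p : ℝ → E → ℝ}
  {G : ℝ → E → E →L[ℝ] E}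

/-- **Integrability of the right-hand side of the local energy inequality.** For a suitable
weak solution with `|u|³, f·u ∈ L¹_loc(Q)` and a test function `ζ` on `Q`, the integrand
`R[ζ] = |u|² (ζₜ + νΔζ) + (|u|² + 2p) u·∇ζ + 2 (f·u) ζ` is integrable on space–time
(the three pieces by the accepted `integrable_mul_of_locallyIntegrableOn`,
`integrable_inner_of_locallyIntegrableOn` with `IsSuitableWeakSolutionOn.locallyIntegrableOn_cubic`,
exactly as inside the proof of `ae_localEnergy_slice`). [folklore] -/
theorem IsSuitableWeakSolutionOn.integrable_localEnergyRHS
    (hs : IsSuitableWeakSolutionOn Q ν f u p)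
    (hu3 : LocallyIntegrableOn (fun z : ℝ × E => ‖u z.1 z.2‖ ^ 3) (Q : Set (ℝ × E)) volume)
    (hfu : LocallyIntegrableOn (fun z : ℝ × E => ⟪f z.1 z.2, u z.1 z.2⟫) (Q : Set (ℝ × E)) volume)
    {ζ : ℝ → E → ℝ} (hζ : IsSpaceTimeTestOn Q ζ) :
    Integrable (localEnergyRHS ν f u p ζ) (volume : Measure (ℝ × E)) := by
  set K := tsupport (uncurry ζ) with hK
  have hKc : IsCompact K := hζ.hasCompactSupport
  have hKQ : K ⊆ (Q : Set (ℝ × E)) := hζ.tsupport_subset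
  have hζ' : IsSpaceTimeTestOn (⊤ : Opens (ℝ × E)) ζ := hζ.mono le_top
  have hcζ : Continuous fun z : ℝ × E => ζ z.1 z.2 := hζ.contDiff.continuous
  have hcT : Continuous fun z : ℝ × E => timeDeriv ζ z.1 z.2 :=
    hζ'.timeDeriv_top.contDiff.continuous
  have hcL : Continuous fun z : ℝ × E => Δ (ζ z.1) z.2 := hζ'.laplacian_top.contDiff.continuous
  obtain ⟨hcg, -, hg0⟩ := hζ.continuous_gradient_field
  have hζK : ∀ z ∉ K, ζ z.1 z.2 = 0 := fun z hz =>
    show uncurry ζ z = 0 from image_eq_zero_of_notMem_tsupport hz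
  have hTK : ∀ z ∉ K, timeDeriv ζ z.1 z.2 = 0 := fun z hz =>
    IsSpaceTimeTestOn.timeDeriv_eq_zero_of_notMem hz
  have hLK : ∀ z ∉ K, Δ (ζ z.1) z.2 = 0 := fun z hz =>
    laplacian_eq_zero_of_notMem_tsupport (notMem_tsupport_slice hz)
  have h1 : Integrable (fun z : ℝ × E =>
      ‖u z.1 z.2‖ ^ 2 * (timeDeriv ζ z.1 z.2 + ν * Δ (ζ z.1) z.2)) (volume : Measure (ℝ × E)) :=
    integrable_mul_of_locallyIntegrableOn hs.distributional.2.1 (hcT.add (continuous_const.mul hcL))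
      hKc hKQ fun z hz => by rw [hTK z hz, hLK z hz]; ring
  have h2 : Integrable (fun z : ℝ × E =>
      ⟪(fun t x => (‖u t x‖ ^ 2 + 2 * p t x) • u t x) z.1 z.2, gradient (ζ z.1) z.2⟫)
      (volume : Measure (ℝ × E)) :=
    integrable_inner_of_locallyIntegrableOn (hs.locallyIntegrableOn_cubic hu3) hcg hKc hKQ hg0
  have h3 : Integrable (fun z : ℝ × E => ⟪f z.1 z.2, u z.1 z.2⟫ * (2 * ζ z.1 z.2))
      (volume : Measure (ℝ × E)) :=
    integrable_mul_of_locallyIntegrableOn hfu (continuous_const.mul hcζ) hKc hKQ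
      fun z hz => by rw [hζK z hz, mul_zero]
  refine ((h1.add h2).add h3).congr (Eventually.of_forall fun z => ?_)
  simp only [localEnergyRHS, real_inner_smul_left, Pi.add_apply]
  ring

/-- **The sliced local energy inequality, `ℝ≥0∞` form.** For `ν ≥ 0`, the conclusion of the
accepted `IsSuitableWeakSolutionOn.ae_localEnergy_slice` with its two nonnegative left-hand
terms written as lower Lebesgue integrals (for a.e. `s` the slice `|u(s)|² ζ(s)` is
integrable, by Fubini, so nothing is lost): for a.e. `s`,
`∫⁻ |u(s)|² ζ(s) + 2ν ∫⁻_{t<s} |∇u|² ζ ≤ ENNReal.ofReal (∫∫_{t<s} R[ζ])`.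
[cite: Lin1998, Def. 1 and (1.4)] -/
theorem IsSuitableWeakSolutionOn.ae_localEnergy_slice_ennreal
    (hs : IsSuitableWeakSolutionOn Q ν f u p) (hG : HasWeakSpatialGradientOn Q u G)
    (hu3 : LocallyIntegrableOn (fun z : ℝ × E => ‖u z.1 z.2‖ ^ 3) (Q : Set (ℝ × E)) volume)
    (hfu : LocallyIntegrableOn (fun z : ℝ × E => ⟪f z.1 z.2, u z.1 z.2⟫) (Q : Set (ℝ × E)) volume)
    {ζ : ℝ → E → ℝ} (hζ : IsSpaceTimeTestOn Q ζ) (hζ0 : ∀ t x, 0 ≤ ζ t x) (hν : 0 ≤ ν) :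
    ∀ᵐ s ∂(volume : Measure ℝ),
      (∫⁻ x, ‖u s x‖ₑ ^ 2 * ENNReal.ofReal (ζ s x)) +
          ENNReal.ofReal (2 * ν) * ∫⁻ z in {z : ℝ × E | z.1 < s},
            ENNReal.ofReal (frobeniusNormSq (G z.1 z.2)) * ENNReal.ofReal (ζ z.1 z.2) ≤
        ENNReal.ofReal (∫ z in {z : ℝ × E | z.1 < s}, localEnergyRHS ν f u p ζ z) := by
  obtain ⟨G₀, hG₀, hG₀2, -⟩ := hs.localEnergy
  have hKc : IsCompact (tsupport (uncurry ζ)) := hζ.hasCompactSupport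
  have hKQ : tsupport (uncurry ζ) ⊆ (Q : Set (ℝ × E)) := hζ.tsupport_subset
  have hcζ : Continuous fun z : ℝ × E => ζ z.1 z.2 := hζ.contDiff.continuous
  have hζK : ∀ z ∉ tsupport (uncurry ζ), ζ z.1 z.2 = 0 := fun z hz =>
    show uncurry ζ z = 0 from image_eq_zero_of_notMem_tsupport hz
  have hHi : Integrable (fun z : ℝ × E => ‖u z.1 z.2‖ ^ 2 * ζ z.1 z.2) (volume : Measure (ℝ × E)) :=
    integrable_mul_of_locallyIntegrableOn hs.distributional.2.1 hcζ hKc hKQ hζK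
  have hslice : ∀ᵐ s ∂(volume : Measure ℝ), Integrable (fun x => ‖u s x‖ ^ 2 * ζ s x) volume := by
    have h := hHi
    rw [Measure.volume_eq_prod] at h
    exact h.prod_right_ae
  have hDi : Integrable (fun z : ℝ × E => frobeniusNormSq (G z.1 z.2) * ζ z.1 z.2)
      (volume : Measure (ℝ × E)) := by
    have h0 : Integrable (fun z : ℝ × E => frobeniusNormSq (G₀ z.1 z.2) * ζ z.1 z.2) volume :=
      integrable_mul_of_locallyIntegrableOn (locallyIntegrableOn_frobeniusNormSq hG₀ hG₀2) hcζ
        hKc hKQ hζK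
    refine h0.congr ?_
    have hae := hG₀.ae_eq hG
    rw [ae_restrict_iff' Q.isOpen.measurableSet] at hae
    filter_upwards [hae] with z hz
    by_cases hzQ : z ∈ (Q : Set (ℝ × E))
    · rw [show G₀ z.1 z.2 = uncurry G₀ z from rfl, hz hzQ]
      rfl
    · rw [hζK z (fun h => hzQ (hKQ h)), mul_zero, mul_zero]
  have hmeas : ∀ s : ℝ, MeasurableSet {z : ℝ × E | z.1 < s} := fun s =>
    measurableSet_lt measurable_fst measurable_const
  filter_upwards [hs.ae_localEnergy_slice hG hu3 hfu hζ hζ0, hslice] with s h1 h2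
  have e1 : ∫⁻ x, ‖u s x‖ₑ ^ 2 * ENNReal.ofReal (ζ s x) =
      ENNReal.ofReal (∫ x, ‖u s x‖ ^ 2 * ζ s x) := by
    rw [ofReal_integral_eq_lintegral_ofReal h2
      (Eventually.of_forall fun x => mul_nonneg (sq_nonneg _) (hζ0 s x))]
    refine lintegral_congr fun x => ?_
    rw [ENNReal.ofReal_mul (sq_nonneg _), ENNReal.ofReal_pow (norm_nonneg _), ofReal_norm]
  have e2 : ∫⁻ z in {z : ℝ × E | z.1 < s},
        ENNReal.ofReal (frobeniusNormSq (G z.1 z.2)) * ENNReal.ofReal (ζ z.1 z.2) =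
      ENNReal.ofReal (∫ z in {z : ℝ × E | z.1 < s}, frobeniusNormSq (G z.1 z.2) * ζ z.1 z.2) := by
    rw [ofReal_integral_eq_lintegral_ofReal hDi.integrableOn
      (Eventually.of_forall fun z => mul_nonneg (frobeniusNormSq_nonneg _) (hζ0 z.1 z.2))]
    exact lintegral_congr fun z => (ENNReal.ofReal_mul (frobeniusNormSq_nonneg _)).symm
  have hD0 : 0 ≤ ∫ z in {z : ℝ × E | z.1 < s}, frobeniusNormSq (G z.1 z.2) * ζ z.1 z.2 :=
    setIntegral_nonneg (hmeas s) fun z _ => mul_nonneg (frobeniusNormSq_nonneg _) (hζ0 z.1 z.2)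
  have hH0 : 0 ≤ ∫ x, ‖u s x‖ ^ 2 * ζ s x :=
    integral_nonneg fun x => mul_nonneg (sq_nonneg _) (hζ0 s x)
  rw [e1, e2, ← ENNReal.ofReal_mul (by positivity), ← ENNReal.ofReal_add hH0 (by positivity)]
  exact ENNReal.ofReal_le_ofReal h1

/-- **The sliced local energy inequality below a time level** (Lin 1998, (1.4);
Seregin–Šverák 2009, Def. 2.2). Same as the accepted
`IsSuitableWeakSolutionOn.ae_localEnergy_slice`, for a nonnegative smooth compactly supported
`ζ` on `ℝ × E` that is supported in `Q` only *below every time level `τ < T`*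
(`tsupport ζ ∩ {t ≤ τ} ⊆ Q`): the sliced inequality then holds for a.e. `s < T`. This is the
form used on backward parabolic cylinders `Q_r(z₀) ⊆ Q` whose top `{t = t₀}` meets the
boundary of `Q`. Proof: multiply `ζ` by smooth time cut-offs `θ_k = 1` on `(-∞, τ_k]`, `= 0`
near `T`, `τ_k ↑ T`, and note that below `τ_k` nothing changes. [cite: Lin1998, Def. 1 and (1.4)] -/
theorem IsSuitableWeakSolutionOn.ae_localEnergy_slice_of_forall_lt
    (hs : IsSuitableWeakSolutionOn Q ν f u p) (hG : HasWeakSpatialGradientOn Q u G)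
    (hu3 : LocallyIntegrableOn (fun z : ℝ × E => ‖u z.1 z.2‖ ^ 3) (Q : Set (ℝ × E)) volume)
    (hfu : LocallyIntegrableOn (fun z : ℝ × E => ⟪f z.1 z.2, u z.1 z.2⟫) (Q : Set (ℝ × E)) volume)
    {ζ : ℝ → E → ℝ} (hζ : IsSpaceTimeTestOn (⊤ : Opens (ℝ × E)) ζ) (hζ0 : ∀ t x, 0 ≤ ζ t x)
    {T : ℝ} (hζQ : ∀ τ < T, tsupport (uncurry ζ) ∩ {z | z.1 ≤ τ} ⊆ (Q : Set (ℝ × E))) :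
    ∀ᵐ s ∂(volume : Measure ℝ), s < T →
      (∫ x, ‖u s x‖ ^ 2 * ζ s x) +
          2 * ν * ∫ z in {z : ℝ × E | z.1 < s}, frobeniusNormSq (G z.1 z.2) * ζ z.1 z.2 ≤
        ∫ z in {z : ℝ × E | z.1 < s}, localEnergyRHS ν f u p ζ z := by
  -- widths `δ k → 0` and cut-offs `θ k = 1` on `(-∞, T - 3 δ k]`, `= 0` on `[T - δ k, ∞)`
  set δ : ℕ → ℝ := fun k => 1 / ((k : ℝ) + 1) with hδ
  have hδ0 : ∀ k, 0 < δ k := fun k => by positivity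
  choose θ ρ hθs hθd hθ1 hθ0 hρ0 hθnn using fun k => exists_time_level_cutoff T (hδ0 k)
  have htest : ∀ k, IsSpaceTimeTestOn Q (fun t x => θ k t * ζ t x) := fun k =>
    hζ.time_mul_of_forall_lt hζQ (hθs k) (by linarith [hδ0 k]) (hθ0 k)
  have hae := ae_all_iff.2 fun k =>
    hs.ae_localEnergy_slice hG hu3 hfu (htest k) (fun t x => mul_nonneg (hθnn k t) (hζ0 t x))
  have hmeas : ∀ s : ℝ, MeasurableSet {z : ℝ × E | z.1 < s} := fun s =>
    measurableSet_lt measurable_fst measurable_const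
  filter_upwards [hae] with s hs' hsT
  -- choose `k` with `s < T - 3 δ k`
  obtain ⟨k, hk⟩ := exists_nat_one_div_lt (show 0 < (T - s) / 3 by linarith)
  have hk' : s < T - 3 * δ k := by
    simp only [hδ]
    linarith
  have h1 : ∀ t ≤ s, θ k t = 1 := fun t ht => hθ1 k t (by linarith)
  have key := hs' k
  -- below `s` nothing has changed
  have e1 : (∫ x, ‖u s x‖ ^ 2 * (θ k s * ζ s x)) = ∫ x, ‖u s x‖ ^ 2 * ζ s x := by
    simp only [h1 s le_rfl, one_mul]
  have e2 : ∫ z in {z : ℝ × E | z.1 < s}, frobeniusNormSq (G z.1 z.2) * (θ k z.1 * ζ z.1 z.2) =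
      ∫ z in {z : ℝ × E | z.1 < s}, frobeniusNormSq (G z.1 z.2) * ζ z.1 z.2 := by
    refine setIntegral_congr_fun (hmeas s) fun z hz => ?_
    simp only [h1 z.1 (le_of_lt hz), one_mul]
  have e3 : ∫ z in {z : ℝ × E | z.1 < s}, localEnergyRHS ν f u p (fun t x => θ k t * ζ t x) z =
      ∫ z in {z : ℝ × E | z.1 < s}, localEnergyRHS ν f u p ζ z := by
    refine setIntegral_congr_fun (hmeas s) fun z hz => ?_
    have hz1 : z.1 < s := hz
    have h := localEnergyRHS_mul_of_hasDerivAt (ν := ν) (f := f) (u := u) (p := p) hζ (hθd k)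
      z.1 z.2
    rw [h1 z.1 hz1.le, hρ0 k z.1 (by linarith), one_mul, zero_mul, add_zero] at h
    exact h
  rw [e1, e2] at key
  refine key.trans (le_of_eq ?_)
  rw [← e3]
  rfl

/-- **The sliced local energy inequality below a time level, `ℝ≥0∞` form** (`ν ≥ 0`):
under the hypotheses of `IsSuitableWeakSolutionOn.ae_localEnergy_slice_of_forall_lt`, for
a.e. `s < T`, `∫⁻ |u(s)|² ζ(s) + 2ν ∫⁻_{t<s} |∇u|² ζ ≤ ENNReal.ofReal (∫∫_{t<s} R[ζ])`.
[cite: Lin1998, Def. 1 and (1.4)] -/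
theorem IsSuitableWeakSolutionOn.ae_localEnergy_slice_ennreal_of_forall_lt
    (hs : IsSuitableWeakSolutionOn Q ν f u p) (hG : HasWeakSpatialGradientOn Q u G)
    (hu3 : LocallyIntegrableOn (fun z : ℝ × E => ‖u z.1 z.2‖ ^ 3) (Q : Set (ℝ × E)) volume)
    (hfu : LocallyIntegrableOn (fun z : ℝ × E => ⟪f z.1 z.2, u z.1 z.2⟫) (Q : Set (ℝ × E)) volume)
    {ζ : ℝ → E → ℝ} (hζ : IsSpaceTimeTestOn (⊤ : Opens (ℝ × E)) ζ) (hζ0 : ∀ t x, 0 ≤ ζ t x)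
    (hν : 0 ≤ ν) {T : ℝ}
    (hζQ : ∀ τ < T, tsupport (uncurry ζ) ∩ {z | z.1 ≤ τ} ⊆ (Q : Set (ℝ × E))) :
    ∀ᵐ s ∂(volume : Measure ℝ), s < T →
      (∫⁻ x, ‖u s x‖ₑ ^ 2 * ENNReal.ofReal (ζ s x)) +
          ENNReal.ofReal (2 * ν) * ∫⁻ z in {z : ℝ × E | z.1 < s},
            ENNReal.ofReal (frobeniusNormSq (G z.1 z.2)) * ENNReal.ofReal (ζ z.1 z.2) ≤
        ENNReal.ofReal (∫ z in {z : ℝ × E | z.1 < s}, localEnergyRHS ν f u p ζ z) := by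
  set δ : ℕ → ℝ := fun k => 1 / ((k : ℝ) + 1) with hδ
  have hδ0 : ∀ k, 0 < δ k := fun k => by positivity
  choose θ ρ hθs hθd hθ1 hθ0 hρ0 hθnn using fun k => exists_time_level_cutoff T (hδ0 k)
  have htest : ∀ k, IsSpaceTimeTestOn Q (fun t x => θ k t * ζ t x) := fun k =>
    hζ.time_mul_of_forall_lt hζQ (hθs k) (by linarith [hδ0 k]) (hθ0 k)
  have hae := ae_all_iff.2 fun k =>
    hs.ae_localEnergy_slice_ennreal hG hu3 hfu (htest k)
      (fun t x => mul_nonneg (hθnn k t) (hζ0 t x)) hν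
  have hmeas : ∀ s : ℝ, MeasurableSet {z : ℝ × E | z.1 < s} := fun s =>
    measurableSet_lt measurable_fst measurable_const
  filter_upwards [hae] with s hs' hsT
  obtain ⟨k, hk⟩ := exists_nat_one_div_lt (show 0 < (T - s) / 3 by linarith)
  have hk' : s < T - 3 * δ k := by
    simp only [hδ]
    linarith
  have h1 : ∀ t ≤ s, θ k t = 1 := fun t ht => hθ1 k t (by linarith)
  have key := hs' k
  have e1 : (∫⁻ x, ‖u s x‖ₑ ^ 2 * ENNReal.ofReal (θ k s * ζ s x)) =
      ∫⁻ x, ‖u s x‖ₑ ^ 2 * ENNReal.ofReal (ζ s x) := by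
    simp only [h1 s le_rfl, one_mul]
  have e2 : ∫⁻ z in {z : ℝ × E | z.1 < s}, ENNReal.ofReal (frobeniusNormSq (G z.1 z.2)) *
        ENNReal.ofReal (θ k z.1 * ζ z.1 z.2) =
      ∫⁻ z in {z : ℝ × E | z.1 < s}, ENNReal.ofReal (frobeniusNormSq (G z.1 z.2)) *
        ENNReal.ofReal (ζ z.1 z.2) := by
    refine setLIntegral_congr_fun (hmeas s) fun z hz => ?_
    simp only [h1 z.1 (le_of_lt hz), one_mul]
  have e3 : ∫ z in {z : ℝ × E | z.1 < s}, localEnergyRHS ν f u p (fun t x => θ k t * ζ t x) z =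
      ∫ z in {z : ℝ × E | z.1 < s}, localEnergyRHS ν f u p ζ z := by
    refine setIntegral_congr_fun (hmeas s) fun z hz => ?_
    have hz1 : z.1 < s := hz
    have h := localEnergyRHS_mul_of_hasDerivAt (ν := ν) (f := f) (u := u) (p := p) hζ (hθd k)
      z.1 z.2
    rw [h1 z.1 hz1.le, hρ0 k z.1 (by linarith), one_mul, zero_mul, add_zero] at h
    exact h
  rw [e1, e2, e3] at key
  exact key

end Main

end Literature.Analysis.FluidPDE
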